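import Summits.HubbardSuperconductivity.HubbardSuperconductivity.Theses.LevyLogBootstrap
import Summits.HubbardSuperconductivity.HubbardSuperconductivity.Theorems.LevyLogBootstrapLevyTransportStubLevyFloor
import Summits.HubbardSuperconductivity.HubbardSuperconductivity.Theorems.LevyLogBootstrapLevyTransportStubLevyMassBranch
import HarnessLib

/-!
# Crux `LevyTransport` (stmt-HubbardSuperconductivity-15049; route `LevyLogBootstrap`, rank 3)
# — BIRTH SKELETON `Lines/birth.lean` (BC3)

THE CRUX (fixed; `Theses/LevyLogBootstrap.lean`, decl `LevyTransport`, concluded BY NAME below, not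
restated): `Block2InfDivXXZ → HalfFilledOrder` — infinite divisibility of the 2×2-block transverse
kernel of the half-filled (`S^z_tot = 0`) sector ground states of
`H_M(Δ) = xxzHamiltonian 1 (torusGraph 2 M) (-1) Δ` on `Δ ∈ [-1,0]` implies planar order
`Re⟨ψ, S⁺_tot S⁻_tot ψ⟩ ≥ c(Δ)·M⁴`, eventually in even `M`, for EVERY `Δ ∈ (-1, 0]`.

THE LINE = the route's own mechanism for this node ("LOG-BOOTSTRAP", route header K2 and TWO-LAYER
PLAN), cut at its three natural joints and typed over ONE auxiliary real quantity, the LÉVY MASS of a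
state (defined here verbatim from the route docstring, no new notion):
`levyMass M ψ := M⁻² Σ_x −log(K₂(x,0)/K₂(0,0))` = the coarse-torus mean of the block log-decoherence
`φ(X) = −log(K₂(X)/K₂(0))` (= `|ν| = Σ_k ν_k` whenever `K₂` is infinitely divisible, Lévy–Khintchine on
`(ℤ/n)²`), where `K₂` is the 2×2-block kernel written as the `M²×M²` matrix EXACTLY as in
`Block2InfDivXXZ`. The four `def`s `IsHalfFilledGS`, `planarOrder`, `transverseKernel`, `blockKernel`
are statement abbreviations (verbatim sub-formulas of the route decls); `levyMass` is the one derived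
quantity. Nothing is assumed in a `def`.

1. `stub_levyMassBranch` — THE GROUND-STATE BRANCH IS A CONTINUOUS CURVE (size M–L; provable with
   effort): for every even `M ≥ 4` there is `g_M : ℝ → ℝ`, continuous on `[-1, 0]`, such that at every
   `Δ ∈ [-1,0]` a normalised half-filled sector ground state EXISTS and EVERY such ground state has
   `levyMass M ψ = g_M Δ`. Content: sector Perron–Frobenius at any `Δ` (LANDED:
   `Theorems.PolyaSchurPairBoson.xxz_sector_perronFrobenius` / `sectorPerronXXZ_proof` — existence of a
   nonneg real sector ground vector, uniqueness up to scalars), strict positivity of the Perron vector on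
   the connected sector graph (so `K₂ > 0` and `log` is the real logarithm), and finite-dimensional
   analytic perturbation theory of the SIMPLE sector ground eigenvalue of the affine family
   `Δ ↦ H_M(Δ)` (Kato, Rellich): the spectral projector, hence `K₂`, hence `levyMass`, is continuous
   (indeed real-analytic) in `Δ` at FIXED `M`. Why it might fail: only through a junk-value slip
   (a zero of `K₂` would make `Real.log` junk) — excluded by strict Perron positivity.
2. `stub_logBootstrap` — THE LOG-BOOTSTRAP CLOSES FROM THE KLS POINT (THE load-bearing stub; size XL;
   = the crux's inputs (a)–(d), route header K2): `Block2InfDivXXZ →` for every `Δ₁ ∈ (-1,0]` there are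
   M-UNIFORM constants `U`, `β ≥ 0` with the FORBIDDEN-GAP condition `β·e^{U+1} < 1` and `M₀` such that
   for every even `M ≥ M₀`: (i) every half-filled sector ground state at every `Δ ∈ [Δ₁, 0]` obeys the
   bootstrap inequality `|ν| ≤ U + β·e^{|ν|}` (`|ν| = levyMass`), and (ii) at the KLS point `Δ = 0`,
   `|ν| ≤ U + 1` (ANCHOR). Derivation foreseen (the second layer, NOT filed now; exactly the route's
   TWO-LAYER PLAN `BlockInfraredBound → PointwiseKLSAnchor → LevyTransport`): (P1) the deterministic
   LÉVY BOOTSTRAP LEMMA for an infinitely divisible positive kernel on `(ℤ/n)²` (Schoenberg / Bochner on a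
   finite abelian group: `φ(X) = Σ_{k≠0} ν_k (1 − cos k·X)`, `ν ≥ 0`, so `|ν| = Σ_{|k|≥κ} ν_k +
   Σ_{0<|k|<κ} ν_k ≤ (φ(e₁)+φ(e₂))/c_κ + e^{|ν|}·Σ_{0<|k|<κ} K̂₂(k)/(n²K₂(0))` by the UV bound
   `2 − cos k₁ − cos k₂ ≥ c_κ` on `|k| ≥ κ` and the Goldstone-wing bound `ν_k ≤ e^{|ν|} K̂₂(k)/(n²K₂(0))`
   — provable now, the new mechanism's engine, fed by `Block2InfDivXXZ`); (P2) input (a), the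
   reflection-positivity / Gaussian-domination infrared bound `K̂₂(k) ≤ B·n²/|k|` for 2-block transverse
   fields of `H_M(Δ)`, uniform on `Δ ∈ [Δ₁, 0]` (Dyson–Lieb–Simon 1978; Kennedy–Lieb–Shastry 1988, T = 0
   form; after the sublattice π-rotation all three couplings are antiferromagnetic on `Δ ∈ [-1,0]`), giving
   `β = β_κ ≈ Bκ/(2πK₂(0))`; (P3) input (b), an M-uniform lower bound on the nearest-neighbour BLOCK
   transverse correlation (energy per bond), giving `U = U_κ = sup(φ(e₁)+φ(e₂))/c_κ`; (P4) input (c), a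
   POINTWISE planar-order anchor `min_X K₂(X) ≥ c₀` at `Δ = 0` uniformly in `M` (expected from RP
   monotonicity of correlations at the XY point; unprinted), giving `|ν|(0) ≤ log(16/c₀)`; (P5) input (d),
   the CERTIFIED numerical compatibility `β_κ e^{U_κ+1} < 1`, `log(16/c₀) ≤ U_κ + 1` for some cutoff `κ`
   (card estimate at block size b = 2 and the KLS point: margin ≈ 0.9 < 1, uncertified). P2–P5 share
   the constants `U, β, c₀`, which is why they are ONE stub at birth: their coupling (P5) is numerical.
   WHY IT MIGHT FAIL (= the crux's): the b = 2 budget is marginal at `Δ = 0` and `B(Δ)`, `Φ₂(Δ)` degrade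
   toward `Δ → -1`, so (P5) may fail on `[Δ_eff ≈ -0.99, 0]` at block size 2 (route kill criterion (2):
   then restate on 4×4 blocks); (P4) is unprinted. The per-`Δ₁` (compact sub-interval) form stated here
   is WEAKER than the route's "uniform on [-1,0]" wording and is all the composition needs.
3. `stub_levyFloor` — "CONDENSATE FRACTION ≥ e^{−LÉVY MASS}" ALONG GROUND STATES (size M; provable now):
   for every even `M ≥ 4`, every real `Δ` and every normalised half-filled sector ground state,
   `e^{−levyMass M ψ}/8 · M⁴ ≤ Re⟨ψ, S⁺_tot S⁻_tot ψ⟩`. Content: Jensen / weighted AM–GM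
   (`M⁻² Σ_x K₂(x,0)/K₂(0,0) ≥ exp(−levyMass)`; the ν-free inequality of support `LevyJensenFloor`,
   stmt-…-15050) + TRANSLATION INVARIANCE of the unique sector ground state (Perron–Frobenius, landed
   as above; torus translations commute with `H_M(Δ)` and preserve the sector), which gives
   `Σ_x K₂(x,0) = 16·Re⟨S⁺_totS⁻_tot⟩/M²` (each site lies in exactly one 2×2 block since `M` is even)
   and `K₂(0,0) ≥ Σ_{x∈B(0)} ⟨S⁺_xS⁻_x⟩ = 4·(½ + ⟨Sᶻ_x⟩) = 2` (`⟨Sᶻ_x⟩ = 0` in the `S^z_tot = 0`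
   sector by translation invariance; off-diagonal block terms `≥ 0` by Perron positivity and the
   nonnegative entries of `spinRaise`/`spinLower`). Why it might fail: it does not, short of a slip in
   the constant `8` (then `16`, immaterial to the crux).

COMPOSITION `LevyTransport_of : Sig.stub₁ → Sig.stub₂ → Sig.stub₃ → LevyLogBootstrap.LevyTransport`
(REAL proof, no `sorry`; the `Sig.stub_*` are syntactic twins of the stub statements keyed by the stub
names so that `#h21_check_skeleton` admits them as hypotheses by name) and
`LevyTransport_skeleton : LevyTransport := LevyTransport_of stub₁ stub₂ stub₃`. The glue is the
FORBIDDEN-GAP CALCULUS, proved here as `forbidden_gap` (the printed SHAPE of the move: Slade's bootstrap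
lemma, *The Lace Expansion and its Applications*, LNM 1879, Lemma 5.9): a function continuous on
`[Δ₁, 0]` that satisfies `g ≤ U + βe^{g}` everywhere, with `βe^{U+1} < 1`, never takes the value
`U + 1` (it would give `U+1 ≤ U + βe^{U+1} < U+1`); since `g(0) ≤ U+1` (anchor), the intermediate value
theorem (`intermediate_value_Icc'`) forces `g < U + 1` on all of `[Δ₁, 0]`. Then, for `M ≥ max M₀ 4`
and a half-filled ground state `ψ` at `Δ`: `levyMass M ψ = g_M(Δ) < U + 1` (stub 1 transfers the
bootstrap inequality and the anchor from ground states to the curve `g_M` and back), and stub 3 gives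
`Re⟨S⁺_totS⁻_tot⟩ ≥ e^{−levyMass}/8·M⁴ ≥ (e^{−(U+1)}/8)·M⁴`, i.e. the crux's consequent with
`c(Δ) = e^{−U(Δ)−1}/8` — exactly the route's "f(Δ) ≥ e^{−U_κ−1}, ⟨S⁺_totS⁻_tot⟩ ≥ (e^{−U_κ−1}/8)·M⁴".

AUDIT (lean check --json, 2026-08-17, this seat): rc 0, errors [], sorries 3 = the three `stub_*` theorems, zero
`sorry` elsewhere (`forbidden_gap`, `LevyTransport_of`, `LevyTransport_skeleton` are real proofs);
`#print axioms LevyTransport_of` = [propext, Classical.choice, Quot.sound]. BC3 PROBES (folder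
`bc/probe_{1,2,3}_{crux,summit}.lean`, definitions copied verbatim, stubs and composition absent so that
`exact?` cannot pick up the sorried skeleton): for each stub `k`, `Sig.stubₖ → LevyTransport` and
`Sig.stubₖ → HubbardSuperconductivity` by `first | exact? | simpa | simpa [Sig.stubₖ] | (unfold Sig.stubₖ;
simpa) | aesop` under `maxHeartbeats 400000` — 6/6 FAIL ("unsolved goals"; aesop: "failed to prove the
goal after exhaustive search"). No stub is cheaply the crux or the summit: stub 1 speaks only of the
Lévy mass along the branch, stub 2 bounds the Lévy mass but not the order (the floor is stub 3) and only
conditionally on continuity + anchor, stub 3 bounds the order by `e^{−levyMass}`, unbounded without stub 2.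

DISPROOF USED: none exists — `ledger crux ls stmt-HubbardSuperconductivity-15049`: no workfiles (no
`Disproof.lean`, no `Theorems/LevyTransport/Negative/*`) on 2026-08-17. `ledger negatives --problem
HubbardSuperconductivity` (2 entries): `CooperPairDMottWalk.not_breathingSelfDual` (unrelated model) and
`AposterioriCapRgKlsOrderOpenness_refuted` (uniform-in-L openness of MOMENTUM-ZERO XY order under generic
U(1)-invariant range-1 perturbations is false: helical Dzyaloshinskii–Moriya twists wind the order to
`q ≠ 0`). No stub here is an instance: continuity (stub 1) is at FIXED `M` only, the deformation is the
inversion-even `Σ SᶻSᶻ` term, and along the whole XXZ family the sector ground state is Perron-positive,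
so its transverse kernel is entrywise positive and its structure factor peaks at `k = 0` — a helix is
impossible; the M-uniform statement (stub 2) is conditional on `Block2InfDivXXZ` and on RP inputs that
the DM-perturbed models do not have.

Sources: KLS1988PRL, KLS1988JSP (T. Kennedy, E. H. Lieb, B. S. Shastry, PRL 61 (1988) 2582; J. Stat.
Phys. 53 (1988) 1019); DysonLiebSimon1978; KuboKishi1988; doi:10.1007/bf01042599; doi:10.1007/b128444
(G. Slade, LNM 1879, Lemma 5.9); Schoenberg1938; BergChristensenRessel1984 ch. 3–4; Bhatia2006;
T. Kato, *Perturbation Theory for Linear Operators* II-§1, §6; H. Tasaki (2020) §2.4; card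
`levy-mass-log-bootstrap`. No Literature definition is introduced.
-/

noncomputable section

-- `dupNamespace`: the summit and the problem are both named `HubbardSuperconductivity` (layout D-0022)
set_option linter.dupNamespace false

namespace Summit.HubbardSuperconductivity.HubbardSuperconductivity.Cruxes.LevyTransport.Birth

open Matrix Finset
open Literature.Probability.LatticeModels Literature.MathematicalPhysics.QuantumLattice
open Summit.HubbardSuperconductivity.HubbardSuperconductivity.Theses.LevyLogBootstrap
open scoped ComplexOrder Matrix

/-! ## Statement abbreviations (verbatim sub-formulas of the route decls) and the Lévy mass -/

/-- `ψ` is a normalised half-filled (`S^z_tot = 0`) sector ground state of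
`H_M(Δ) = xxzHamiltonian 1 (torusGraph 2 M) (-1) Δ` — the three hypotheses of `LevyTransport` /
`HalfFilledOrder` / `Block2InfDivXXZ`, verbatim. [folklore] -/
def IsHalfFilledGS (M : ℕ) [NeZero M] (Δ : ℝ) (ψ : TensorIndex (TorusSite 2 M) 2 → ℂ) : Prop :=
  ψ ∈ spinZSector (Λ := TorusSite 2 M) 1 0 ∧ star ψ ⬝ᵥ ψ = 1 ∧
    Matrix.mulVec (xxzHamiltonian 1 (torusGraph 2 M) (-1) Δ) ψ =
      ((lowestEnergyInSector 1 (xxzHamiltonian 1 (torusGraph 2 M) (-1) Δ) 0 : ℝ) : ℂ) • ψ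

/-- The planar order parameter `Re⟨ψ, S⁺_tot S⁻_tot ψ⟩` — the right-hand side of `LevyTransport`'s
consequent, verbatim. [folklore] -/
def planarOrder (M : ℕ) [NeZero M] (ψ : TensorIndex (TorusSite 2 M) 2 → ℂ) : ℝ :=
  (star ψ ⬝ᵥ Matrix.mulVec ((∑ x : TorusSite 2 M, onSite x (spinRaise 1)) *
    (∑ y : TorusSite 2 M, onSite y (spinLower 1))) ψ).re

/-- The transverse kernel `K(x,y) = Re⟨ψ, S⁺_x S⁻_y ψ⟩` (as inside `Block2InfDivXXZ`). [folklore] -/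
def transverseKernel (M : ℕ) [NeZero M] (ψ : TensorIndex (TorusSite 2 M) 2 → ℂ)
    (x y : TorusSite 2 M) : ℝ :=
  (star ψ ⬝ᵥ Matrix.mulVec (onSite x (spinRaise 1) * onSite y (spinLower 1)) ψ).re

/-- The 2×2-BLOCK transverse kernel `K₂(x,y) = Σ_{x'∈B(x), y'∈B(y)} K(x',y')`, `B(x)` = the 2×2 block
`(⌊x₀/2⌋, ⌊x₁/2⌋)` of `x`, written as an `M²×M²` kernel exactly as in `Block2InfDivXXZ` (whose
`Matrix.of` entries are `(blockKernel M ψ x y) ^ s`). [folklore] -/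
def blockKernel (M : ℕ) [NeZero M] (ψ : TensorIndex (TorusSite 2 M) 2 → ℂ)
    (x y : TorusSite 2 M) : ℝ :=
  ∑ x' : TorusSite 2 M, ∑ y' : TorusSite 2 M,
    if (∀ i : Fin 2, (x' i).val / 2 = (x i).val / 2) ∧ (∀ i : Fin 2, (y' i).val / 2 = (y i).val / 2)
    then transverseKernel M ψ x' y' else 0

/-- The LÉVY MASS `|ν|(ψ) := M⁻² Σ_x −log(K₂(x,0)/K₂(0,0))` of a state: the mean over the torus of the
block log-decoherence `φ(x) = −log(K₂(x,0)/K₂(0,0))` (each coarse site counted four times and divided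
by `M² = 4n²`, i.e. the coarse mean `n⁻² Σ_X φ(X)`); for an infinitely divisible translation-invariant
`K₂` this is the total mass `Σ_{k≠0} ν_k` of its Lévy measure (route header: "its LÉVY MASS
|ν| = mean_X φ"). Junk (harmless) when some `K₂(x,0) ≤ 0`. [folklore] -/
def levyMass (M : ℕ) [NeZero M] (ψ : TensorIndex (TorusSite 2 M) 2 → ℂ) : ℝ :=
  (∑ x : TorusSite 2 M, -Real.log (blockKernel M ψ x 0 / blockKernel M ψ 0 0)) / (M : ℝ) ^ 2

/-! ## The glue lemma: the forbidden-gap calculus (proved) -/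

/-- **Forbidden-gap bootstrap lemma** (the shape of Slade's Lemma 5.9, here with the exponential
bootstrap function of the route): if `g` is continuous on `[a, 0]`, satisfies `g t ≤ U + β·exp (g t)`
there, the level `U + 1` is forbidden (`β·e^{U+1} < 1`) and the anchor `g 0 ≤ U + 1` holds, then
`g t < U + 1` on all of `[a, 0]` (intermediate value theorem). [folklore] -/
theorem forbidden_gap {g : ℝ → ℝ} {a U β : ℝ} (ha : a ≤ 0)
    (hg : ContinuousOn g (Set.Icc a 0)) (hβ : β * Real.exp (U + 1) < 1)
    (hineq : ∀ t ∈ Set.Icc a 0, g t ≤ U + β * Real.exp (g t)) (h0 : g 0 ≤ U + 1) :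
    ∀ t ∈ Set.Icc a 0, g t < U + 1 := by
  -- the level `U + 1` is never attained
  have hforb : ∀ t ∈ Set.Icc a 0, g t ≠ U + 1 := by
    intro t ht heq
    have h := hineq t ht
    rw [heq] at h
    linarith
  have h0' : g 0 < U + 1 := lt_of_le_of_ne h0 (hforb 0 ⟨ha, le_rfl⟩)
  intro t ht
  by_contra hge
  have hge' : U + 1 ≤ g t := not_lt.mp hge
  have hgt : U + 1 < g t := lt_of_le_of_ne hge' (fun h => hforb t ht h.symm)
  have hsub : Set.Icc t 0 ⊆ Set.Icc a 0 := Set.Icc_subset_Icc ht.1 le_rfl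
  have hcont : ContinuousOn g (Set.Icc t 0) := hg.mono hsub
  obtain ⟨s, hs, hseq⟩ := intermediate_value_Icc' ht.2 hcont ⟨h0'.le, hgt.le⟩
  exact hforb s (hsub hs) hseq

/-! ## The three stubs -/

/-- **STUB 1 `stub_levyMassBranch` — THE HALF-FILLED GROUND-STATE BRANCH IS A CONTINUOUS CURVE**
(fixed `M`; existence + phase-independence + continuity of the Lévy mass along `Δ ∈ [-1,0]`).
For every even `M ≥ 4` there is `g : ℝ → ℝ`, continuous on `Set.Icc (-1) 0`, such that for every
`Δ ∈ [-1,0]` a normalised `S^z_tot = 0` sector ground state of `H_M(Δ)` exists and every such ground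
state `ψ` has `levyMass M ψ = g Δ`. Sector Perron–Frobenius at any `Δ` (landed:
`Theorems.PolyaSchurPairBoson.xxz_sector_perronFrobenius`, `sectorPerronXXZ_proof`) + strict Perron
positivity on the connected sector graph + analytic perturbation theory of a simple eigenvalue of the
affine family `Δ ↦ H_M(Δ)` in finite dimension (Kato II-§1). Tasaki (2020) §2.4; Kato (1966). -/
theorem stub_levyMassBranch :
    ∀ (M : ℕ) [NeZero M], Even M → 4 ≤ M →
      ∃ g : ℝ → ℝ, ContinuousOn g (Set.Icc (-1:ℝ) 0) ∧
        ∀ Δ ∈ Set.Icc (-1:ℝ) 0,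
          (∃ ψ : TensorIndex (TorusSite 2 M) 2 → ℂ, IsHalfFilledGS M Δ ψ) ∧
          ∀ ψ : TensorIndex (TorusSite 2 M) 2 → ℂ, IsHalfFilledGS M Δ ψ → levyMass M ψ = g Δ := by
  intro M _ hE h4
  exact Summit.HubbardSuperconductivity.HubbardSuperconductivity.Theorems.LevyLogBootstrap.stub_levyMassBranch_explicit
    M hE h4

/-- **STUB 2 `stub_logBootstrap` — THE BLOCK LOG-BOOTSTRAP CLOSES FROM THE KLS POINT** (THE
load-bearing stub = the crux's inputs (a) infrared bound, (b) local block coherence, (c) pointwise KLS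
anchor, (d) certified constants, fed by `Block2InfDivXXZ` through the Lévy bootstrap lemma (P1) — see
the module docstring for the foreseen second-layer split P1–P5). `Block2InfDivXXZ →` for every
`Δ₁ ∈ (-1, 0]` there are M-uniform `U`, `β ≥ 0` with the forbidden-gap condition `β·e^{U+1} < 1` and
`M₀` such that for every even `M ≥ M₀`: every normalised half-filled sector ground state at every
`Δ ∈ [Δ₁, 0]` satisfies `levyMass ≤ U + β·exp levyMass`, and every one at the KLS point `Δ = 0`
satisfies the anchor `levyMass ≤ U + 1`. Not claimed provable now; the numerical coupling (d) of the
constants is why (a)–(d) are one stub at birth. Kennedy–Lieb–Shastry (1988) PRL + JSP;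
Dyson–Lieb–Simon (1978); Kubo–Kishi (1988); Schoenberg (1938); Berg–Christensen–Ressel (1984) ch. 3–4;
card `levy-mass-log-bootstrap`. -/
theorem stub_logBootstrap :
    Block2InfDivXXZ →
      ∀ Δ₁ ∈ Set.Ioc (-1:ℝ) 0, ∃ U β : ℝ, 0 ≤ β ∧ β * Real.exp (U + 1) < 1 ∧
        ∃ M₀ : ℕ, ∀ (M : ℕ) [NeZero M], Even M → M₀ ≤ M →
          (∀ Δ ∈ Set.Icc Δ₁ 0, ∀ ψ : TensorIndex (TorusSite 2 M) 2 → ℂ, IsHalfFilledGS M Δ ψ →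
              levyMass M ψ ≤ U + β * Real.exp (levyMass M ψ)) ∧
          (∀ ψ : TensorIndex (TorusSite 2 M) 2 → ℂ, IsHalfFilledGS M 0 ψ →
              levyMass M ψ ≤ U + 1) := by
  sorry

/-- **STUB 3 `stub_levyFloor` — CONDENSATE FRACTION ≥ e^{−LÉVY MASS} ALONG GROUND STATES** (Jensen +
translation invariance of the unique sector ground state). For every even `M ≥ 4`, every real `Δ` and
every normalised half-filled sector ground state `ψ` of `H_M(Δ)`:
`exp (−levyMass M ψ) / 8 · M⁴ ≤ Re⟨ψ, S⁺_tot S⁻_tot ψ⟩`. Jensen (`M⁻² Σ_x K₂(x,0)/K₂(0,0) ≥ e^{−|ν|}`,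
the ν-free floor of support `LevyJensenFloor`), `Σ_x K₂(x,0) = 16·Re⟨S⁺_totS⁻_tot⟩/M²` and
`K₂(0,0) ≥ 2` by translation invariance (Perron–Frobenius uniqueness, landed `sectorPerronXXZ_proof`)
and `S⁺_xS⁻_x = ½ + Sᶻ_x`. Berg–Christensen–Ressel (1984); Bhatia (2006); Tasaki (2020) §2.4. -/
theorem stub_levyFloor :
    ∀ (M : ℕ) [NeZero M], Even M → 4 ≤ M → ∀ (Δ : ℝ) (ψ : TensorIndex (TorusSite 2 M) 2 → ℂ),
      IsHalfFilledGS M Δ ψ → Real.exp (-levyMass M ψ) / 8 * (M : ℝ) ^ 4 ≤ planarOrder M ψ := by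
  intro M _ hE h4 Δ ψ hψ
  exact Summit.HubbardSuperconductivity.HubbardSuperconductivity.Theorems.LevyLogBootstrap.stub_levyFloor_explicit
    M hE h4 Δ ψ hψ

/-! ## Syntactic twins of the stub statements (hypothesis names for the composition) -/

/-- Twin of `stub_levyMassBranch` (same statement, by name). [folklore] -/
def Sig.stub_levyMassBranch : Prop :=
    ∀ (M : ℕ) [NeZero M], Even M → 4 ≤ M →
      ∃ g : ℝ → ℝ, ContinuousOn g (Set.Icc (-1:ℝ) 0) ∧
        ∀ Δ ∈ Set.Icc (-1:ℝ) 0,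
          (∃ ψ : TensorIndex (TorusSite 2 M) 2 → ℂ, IsHalfFilledGS M Δ ψ) ∧
          ∀ ψ : TensorIndex (TorusSite 2 M) 2 → ℂ, IsHalfFilledGS M Δ ψ → levyMass M ψ = g Δ

/-- Twin of `stub_logBootstrap` (same statement, by name). [folklore] -/
def Sig.stub_logBootstrap : Prop :=
    Block2InfDivXXZ →
      ∀ Δ₁ ∈ Set.Ioc (-1:ℝ) 0, ∃ U β : ℝ, 0 ≤ β ∧ β * Real.exp (U + 1) < 1 ∧
        ∃ M₀ : ℕ, ∀ (M : ℕ) [NeZero M], Even M → M₀ ≤ M →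
          (∀ Δ ∈ Set.Icc Δ₁ 0, ∀ ψ : TensorIndex (TorusSite 2 M) 2 → ℂ, IsHalfFilledGS M Δ ψ →
              levyMass M ψ ≤ U + β * Real.exp (levyMass M ψ)) ∧
          (∀ ψ : TensorIndex (TorusSite 2 M) 2 → ℂ, IsHalfFilledGS M 0 ψ →
              levyMass M ψ ≤ U + 1)

/-- Twin of `stub_levyFloor` (same statement, by name). [folklore] -/
def Sig.stub_levyFloor : Prop :=
    ∀ (M : ℕ) [NeZero M], Even M → 4 ≤ M → ∀ (Δ : ℝ) (ψ : TensorIndex (TorusSite 2 M) 2 → ℂ),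
      IsHalfFilledGS M Δ ψ → Real.exp (-levyMass M ψ) / 8 * (M : ℝ) ^ 4 ≤ planarOrder M ψ

/-! ## The composition: the three stubs imply the crux, by name -/

/-- **`LevyTransport_of`** — literal shape `stub₁-sig → stub₂-sig → stub₃-sig → LevyTransport`, REAL
proof (no `sorry`), concluding the route decl BY NAME. Glue = the forbidden-gap calculus
(`forbidden_gap`) on the continuous ground-state curve `g_M` of stub 1, fed by the bootstrap inequality
and the anchor of stub 2, then the Jensen floor of stub 3: `c(Δ) = e^{−(U+1)}/8`, `M₀' = max M₀ 4`.
[folklore] -/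
theorem LevyTransport_of (h₁ : Sig.stub_levyMassBranch) (h₂ : Sig.stub_logBootstrap)
    (h₃ : Sig.stub_levyFloor) :
    Summit.HubbardSuperconductivity.HubbardSuperconductivity.Theses.LevyLogBootstrap.LevyTransport := by
  unfold Sig.stub_levyMassBranch at h₁
  unfold Sig.stub_logBootstrap at h₂
  unfold Sig.stub_levyFloor at h₃
  intro hK1 Δ hΔ
  obtain ⟨U, β, _hβ0, hβ1, M₀, hM⟩ := h₂ hK1 Δ hΔ
  refine ⟨Real.exp (-(U + 1)) / 8, by positivity, max M₀ 4, ?_⟩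
  intro M _ hEven hM₀ ψ hsec hnorm heig
  have h4 : 4 ≤ M := le_trans (le_max_right M₀ 4) hM₀
  have hM₀' : M₀ ≤ M := le_trans (le_max_left M₀ 4) hM₀
  obtain ⟨hineq, hanchor⟩ := hM M hEven hM₀'
  obtain ⟨g, hg_cont, hg⟩ := h₁ M hEven h4
  have hGS : IsHalfFilledGS M Δ ψ := ⟨hsec, hnorm, heig⟩
  have hΔI : Δ ∈ Set.Icc (-1:ℝ) 0 := ⟨le_of_lt hΔ.1, hΔ.2⟩
  -- the bootstrap inequality, transferred to the curve `g` on `[Δ, 0]`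
  have hg_ineq : ∀ t ∈ Set.Icc Δ 0, g t ≤ U + β * Real.exp (g t) := by
    intro t ht
    have htI : t ∈ Set.Icc (-1:ℝ) 0 := ⟨le_trans hΔI.1 ht.1, ht.2⟩
    obtain ⟨⟨ψ', hψ'⟩, huniq⟩ := hg t htI
    rw [← huniq ψ' hψ']
    exact hineq t ht ψ' hψ'
  -- the anchor at the KLS point, transferred to `g 0`
  have hg0 : g 0 ≤ U + 1 := by
    have h0I : (0:ℝ) ∈ Set.Icc (-1:ℝ) 0 := ⟨by norm_num, le_rfl⟩
    obtain ⟨⟨ψ₀, hψ₀⟩, huniq⟩ := hg 0 h0I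
    rw [← huniq ψ₀ hψ₀]
    exact hanchor ψ₀ hψ₀
  -- forbidden gap + continuity (IVT): the curve stays below `U + 1` on `[Δ, 0]`
  have hcontΔ : ContinuousOn g (Set.Icc Δ 0) := hg_cont.mono (Set.Icc_subset_Icc hΔI.1 le_rfl)
  have hgap : g Δ < U + 1 :=
    forbidden_gap hΔ.2 hcontΔ hβ1 hg_ineq hg0 Δ ⟨le_rfl, hΔ.2⟩
  have hL : levyMass M ψ < U + 1 := by
    rw [(hg Δ hΔI).2 ψ hGS]
    exact hgap
  -- the Jensen floor turns the Lévy-mass bound into planar order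
  have hfl := h₃ M hEven h4 Δ ψ hGS
  have hexp : Real.exp (-(U + 1)) ≤ Real.exp (-levyMass M ψ) :=
    Real.exp_le_exp.mpr (by linarith)
  have hc : Real.exp (-(U + 1)) / 8 ≤ Real.exp (-levyMass M ψ) / 8 := by linarith
  have hM4 : (0:ℝ) ≤ (M : ℝ) ^ 4 := by positivity
  exact le_trans (mul_le_mul_of_nonneg_right hc hM4) hfl

/-- The stubs themselves feed the composition (their statements are the `Sig` twins, syntactically):
the skeleton of the crux, `sorry` only through the three declared stubs. [folklore] -/
theorem LevyTransport_skeleton :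
    Summit.HubbardSuperconductivity.HubbardSuperconductivity.Theses.LevyLogBootstrap.LevyTransport :=
  LevyTransport_of stub_levyMassBranch stub_logBootstrap stub_levyFloor

end Summit.HubbardSuperconductivity.HubbardSuperconductivity.Cruxes.LevyTransport.Birth

end
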